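import Summits.AnomalousDissipation.AnomalousDissipation.Theorems.SolenoidalFractalHomogenisationLagrangianStepSidebandXDefsFrame
import Summits.AnomalousDissipation.AnomalousDissipation.Theorems.SolenoidalFractalHomogenisationLagrangianStepSidebandSkewFrame
import Summits.AnomalousDissipation.AnomalousDissipation.Theorems.SolenoidalFractalHomogenisationLagrangianStepSidebandXGen
import HarnessLib

/-!
# K1L_D `LagrangianRenormalisationStepDesign` (stmt-AnomalousDissipation-27980), registered stub `stub_D1_V0thg` (v28, ruling D28-3 (3)), port-map layer L5:
# the FROZEN-FRAME finite-ξ truncated generator `genXθ` is SKEW + DISSIPATIVE with the full symbol form retained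
# (helper; `--supports stmt-AnomalousDissipation-27980 --as helper`)

Summits-side helper file of route `SolenoidalFractalHomogenisation` (prover seat `ad-k1l-cellLawV-w1` g9; port map
`Cruxes/LagrangianRenormalisationStepDesign/Lines/onelevel-vtheta-twist-portmap.md` §3 L5, ruling D28-7).  The frozen-frame twin of `…SidebandXGen` for the objects
of `…SidebandXDefsFrame` (`genXCompθ`, `genXθ`: `P_{k_z} ↦ P^θ_{k_z} = transversalProjR (twistFreq G₀ k_z)`, `T_{𝔹ᵀ} ↦ T_{(𝔹^{G₀})ᵀ}`); the §1 link lemmas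
(`linkCoeff_classFreq_*`, `linkCoeff_slow_eq`) are flat and REUSED BY NAME.  Everything proved; no definitions, no named facts, no sorry.
* `transversalProjR_classFreq_coordL_eq_sum`, **`sum_re_inner_linkX_eq_zero_frame`** — the skew identity of the links at finite ξ with twisted projections;
* `genXCompθ_apply`, `re_inner_genXCompθ`, **`real_inner_genXθ_eq`** — the fibre balance; the links create no energy;
* **`real_inner_genXθ_le_twist`** — `⟪genXθ y, y⟫_ℝ ≤ −4π²·lo'·Σ_z |G₀ᵀk_z|²·‖P^θ y_z‖² − γ₁ Σ_z (‖y_z‖² − ‖P^θ y_z‖²)` (`NearIso 𝔹 lo' hi'`, exact twisted weights);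
  **`real_inner_genXθ_le`** — the flat shape with `lo' ↦ lo'·c` under the frame hypothesis `c|k|² ≤ |G₀ᵀk|²`.
At `G₀ = 1` these are literally the flat statements (`genXθ_one_zero`/`genXCompθ_one`, `twistFreq_one`).
NOT a proof of any registered stub, of the crux, or of anomalous dissipation; rung F-D1 infrastructure for the `stub_D1_V0thg` engine.
-/

set_option linter.dupNamespace false

noncomputable section

namespace Summit.AnomalousDissipation.AnomalousDissipation.Theorems.SolenoidalFractalHomogenisation.LagrangianStep.Sideband

open Set MeasureTheory Complex UnitAddTorus
open scoped InnerProductSpace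
open Literature.Analysis Literature.Analysis.FunctionSpaces Literature.Analysis.FunctionSpaces.Torus
open Literature.Analysis.FluidPDE Literature.Analysis.FluidPDE.Torus Literature.Analysis.FluidPDE.LatticeShear
open Summit.AnomalousDissipation.AnomalousDissipation.Theorems.SolenoidalFractalHomogenisation.LagrangianStep.CellChain
  (linkCoeff conj_linkCoeff linkCoeff_chain rdot_transversalProjR')

variable {k₀ : ℕ}

/-! ## §1 The skew identity at finite ξ (twisted projections) -/

/-- The class-projected amplitude read through `coordL` is a one-term sum over the box. [cite: MajdaKramer1999, §2.2.1.3] -/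
theorem transversalProjR_classFreq_coordL_eq_sum (G₀ : Matrix (Fin 3) (Fin 3) ℝ) {R : ℕ} (n : ℕ) (ℓ w : Fin 3 → ℤ) (y : Space R) :
    transversalProjR (twistFreq G₀ (classFreq n ℓ w)) (coordL R w y) =
      ∑ z' : box R, if (z' : Fin 3 → ℤ) = w then transversalProjR (twistFreq G₀ (classFreq n ℓ z'.1)) (y z') else 0 := by
  classical
  by_cases hw : w ∈ box R
  · rw [coordL_apply_of_mem hw, Finset.sum_eq_single (⟨w, hw⟩ : box R)]
    · simp
    · intro z' _ hz'
      have : (z' : Fin 3 → ℤ) ≠ w := fun h => hz' (Subtype.ext h)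
      simp [this]
    · intro h; exact absurd (Finset.mem_univ _) h
  · rw [coordL_apply_of_not_mem hw, map_zero]
    symm
    refine Finset.sum_eq_zero fun z' _ => ?_
    have : (z' : Fin 3 → ℤ) ≠ w := fun h => hw (h ▸ z'.2)
    simp [this]

/-- **The skew identity of the links on the truncated CLASS lattice** (finite ξ): for every slot `j` and state `y`,
`Σ_{z∈box} Re⟪linkCoeffⱼ(k_z,t) • P_{k_z}(αⱼ P_{k_{z−mⱼ}} y_{z−mⱼ} + ᾱⱼ P_{k_{z+mⱼ}} y_{z+mⱼ}), y_z⟫ = 0`.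
[cite: MeshalkinSinai1961, pp. 1700–1705] [cite: MajdaKramer1999, §2.2.1.3] -/
theorem sum_re_inner_linkX_eq_zero_frame (W₁ : LatticeWord k₀) (n : ℕ) (ℓ : Fin 3 → ℤ) (G₀ : Matrix (Fin 3) (Fin 3) ℝ) (R : ℕ) (j : Fin k₀) (t : ℝ) (y : Space R) :
    ∑ z : box R, (⟪linkCoeff W₁ n (classFreq n ℓ z.1) j t • transversalProjR (twistFreq G₀ (classFreq n ℓ z.1))
        (slotAmp W₁ j • transversalProjR (twistFreq G₀ (classFreq n ℓ (z.1 - (W₁.phase j).m))) (coordL R (z.1 - (W₁.phase j).m) y) +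
          starRingEnd ℂ (slotAmp W₁ j) • transversalProjR (twistFreq G₀ (classFreq n ℓ (z.1 + (W₁.phase j).m))) (coordL R (z.1 + (W₁.phase j).m) y)),
        y z⟫_ℂ).re = 0 := by
  classical
  obtain ⟨m, hm⟩ : ∃ m : Fin 3 → ℤ, m = (W₁.phase j).m := ⟨_, rfl⟩
  obtain ⟨α, hα⟩ : ∃ α : ℂ, α = slotAmp W₁ j := ⟨_, rfl⟩
  obtain ⟨c, hc⟩ : ∃ c : (Fin 3 → ℤ) → ℂ, ∀ w, c w = linkCoeff W₁ n (classFreq n ℓ w) j t := ⟨_, fun _ => rfl⟩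
  obtain ⟨u, hu⟩ : ∃ u : box R → EuclideanSpace ℂ (Fin 3), ∀ z, u z = transversalProjR (twistFreq G₀ (classFreq n ℓ z.1)) (y z) := ⟨_, fun _ => rfl⟩
  obtain ⟨X, hX⟩ : ∃ X : box R → box R → ℂ, ∀ a b, X a b =
      if (b : Fin 3 → ℤ) = a.1 - m then starRingEnd ℂ (c a.1) * (starRingEnd ℂ α * ⟪u b, u a⟫_ℂ) else 0 := ⟨_, fun _ _ => rfl⟩
  obtain ⟨Y, hY⟩ : ∃ Y : box R → box R → ℂ, ∀ a b, Y a b =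
      if (b : Fin 3 → ℤ) = a.1 + m then starRingEnd ℂ (c a.1) * (α * ⟪u b, u a⟫_ℂ) else 0 := ⟨_, fun _ _ => rfl⟩
  rw [← hm, ← hα]
  have key : ∀ z : box R, ⟪linkCoeff W₁ n (classFreq n ℓ z.1) j t • transversalProjR (twistFreq G₀ (classFreq n ℓ z.1))
        (α • transversalProjR (twistFreq G₀ (classFreq n ℓ (z.1 - m))) (coordL R (z.1 - m) y) +
          starRingEnd ℂ α • transversalProjR (twistFreq G₀ (classFreq n ℓ (z.1 + m))) (coordL R (z.1 + m) y)), y z⟫_ℂ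
      = ∑ z', X z z' + ∑ z', Y z z' := by
    intro z
    rw [inner_smul_left, inner_transversalProjR_comm, ← hu z, ← hc z.1, inner_add_left, inner_smul_left, inner_smul_left,
      starRingEnd_self_apply, transversalProjR_classFreq_coordL_eq_sum, transversalProjR_classFreq_coordL_eq_sum, sum_inner, sum_inner]
    have hA : ∑ z' : box R, ⟪(if (z' : Fin 3 → ℤ) = z.1 - m then transversalProjR (twistFreq G₀ (classFreq n ℓ z'.1)) (y z') else 0), u z⟫_ℂ =
        ∑ z' : box R, (if (z' : Fin 3 → ℤ) = z.1 - m then ⟪u z', u z⟫_ℂ else 0) := by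
      refine Finset.sum_congr rfl fun z' _ => ?_
      split_ifs
      · rw [hu z']
      · exact inner_zero_left _
    have hB : ∑ z' : box R, ⟪(if (z' : Fin 3 → ℤ) = z.1 + m then transversalProjR (twistFreq G₀ (classFreq n ℓ z'.1)) (y z') else 0), u z⟫_ℂ =
        ∑ z' : box R, (if (z' : Fin 3 → ℤ) = z.1 + m then ⟪u z', u z⟫_ℂ else 0) := by
      refine Finset.sum_congr rfl fun z' _ => ?_
      split_ifs
      · rw [hu z']
      · exact inner_zero_left _
    rw [hA, hB, mul_add, Finset.mul_sum, Finset.mul_sum, Finset.mul_sum, Finset.mul_sum]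
    congr 1
    · refine Finset.sum_congr rfl fun z' _ => ?_
      rw [hX z z']
      simp only [mul_ite, mul_zero]
    · refine Finset.sum_congr rfl fun z' _ => ?_
      rw [hY z z']
      simp only [mul_ite, mul_zero]
  have pair : ∀ a b : box R, (X a b + Y b a).re = 0 := by
    intro a b
    rw [hX a b, hY b a]
    by_cases hab : (b : Fin 3 → ℤ) = a.1 - m
    · have hba : (a : Fin 3 → ℤ) = b.1 + m := by rw [hab]; abel
      rw [if_pos hab, if_pos hba]
      have hcb : c b.1 = c a.1 := by
        rw [hc, hc, hab, hm]; exact linkCoeff_classFreq_sub W₁ n ℓ a.1 j t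
      rw [hcb, ← mul_add]
      have hw : starRingEnd ℂ α * ⟪u b, u a⟫_ℂ + α * ⟪u a, u b⟫_ℂ = ((2 * (α * ⟪u a, u b⟫_ℂ).re : ℝ) : ℂ) := by
        have h1 : starRingEnd ℂ α * ⟪u b, u a⟫_ℂ = starRingEnd ℂ (α * ⟪u a, u b⟫_ℂ) := by
          rw [map_mul, inner_conj_symm]
        rw [h1, add_comm, Complex.add_conj]
      rw [hw, hc]
      exact re_conj_linkCoeff_mul_real W₁ n (classFreq n ℓ a.1) j t _
    · have hba : ¬ (a : Fin 3 → ℤ) = b.1 + m := fun h => hab (by rw [h]; abel)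
      rw [if_neg hab, if_neg hba, add_zero, Complex.zero_re]
  calc ∑ z : box R, (⟪linkCoeff W₁ n (classFreq n ℓ z.1) j t • transversalProjR (twistFreq G₀ (classFreq n ℓ z.1))
        (α • transversalProjR (twistFreq G₀ (classFreq n ℓ (z.1 - m))) (coordL R (z.1 - m) y) +
          starRingEnd ℂ α • transversalProjR (twistFreq G₀ (classFreq n ℓ (z.1 + m))) (coordL R (z.1 + m) y)), y z⟫_ℂ).re
      = ∑ a : box R, ((∑ b, X a b) + ∑ b, Y a b).re := Finset.sum_congr rfl fun z _ => by rw [key z]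
    _ = ∑ a : box R, ∑ b : box R, (X a b).re + ∑ a : box R, ∑ b : box R, (Y a b).re := by
        simp only [Complex.add_re, Complex.re_sum, Finset.sum_add_distrib]
    _ = ∑ a : box R, ∑ b : box R, (X a b).re + ∑ b : box R, ∑ a : box R, (Y a b).re := by
        rw [Finset.sum_comm (f := fun a b => (Y a b).re)]
    _ = ∑ a : box R, ∑ b : box R, ((X a b).re + (Y b a).re) := by
        rw [← Finset.sum_add_distrib]
        refine Finset.sum_congr rfl fun a _ => ?_
        rw [← Finset.sum_add_distrib]
    _ = 0 := Finset.sum_eq_zero fun a _ => Finset.sum_eq_zero fun b _ => by rw [← Complex.add_re, pair a b]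

/-! ## §2 The fibre balance and the dissipativity of `genXθ` with the symbol form retained -/

/-- **Components of the finite-ξ generator, applied.** [cite: MajdaKramer1999, §2.2.1.3 (cell problem (49))] -/
theorem genXCompθ_apply (W₁ : LatticeWord k₀) (n : ℕ) (ℓ : Fin 3 → ℤ) (𝔹 : Torus.Visc4 (Fin 3)) (G₀ : Matrix (Fin 3) (Fin 3) ℝ) (γ₁ : ℝ) (R : ℕ) (t : ℝ) (z : box R) (y : Space R) :
    genXCompθ W₁ n ℓ 𝔹 G₀ γ₁ R t z y =
      -((((4 * Real.pi ^ 2 : ℝ) : ℂ)) • transversalProjR (twistFreq G₀ (classFreq n ℓ z.1))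
          (Torus.symbT (Torus.majorTranspose (Torus.Visc4.conj G₀ 𝔹)) (classFreq n ℓ z.1) (transversalProjR (twistFreq G₀ (classFreq n ℓ z.1)) (coordL R z.1 y)))) -
      ((γ₁ : ℝ) : ℂ) • (coordL R z.1 y - transversalProjR (twistFreq G₀ (classFreq n ℓ z.1)) (coordL R z.1 y)) -
      ∑ j, linkCoeff W₁ n (classFreq n ℓ z.1) j t • transversalProjR (twistFreq G₀ (classFreq n ℓ z.1))
        (slotAmp W₁ j • transversalProjR (twistFreq G₀ (classFreq n ℓ (z.1 - (W₁.phase j).m))) (coordL R (z.1 - (W₁.phase j).m) y) +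
          starRingEnd ℂ (slotAmp W₁ j) • transversalProjR (twistFreq G₀ (classFreq n ℓ (z.1 + (W₁.phase j).m))) (coordL R (z.1 + (W₁.phase j).m) y)) := by
  have hsum : (∑ j, linkCoeff W₁ n (classFreq n ℓ z.1) j t • ((transversalProjR (twistFreq G₀ (classFreq n ℓ z.1))).comp
      (slotAmp W₁ j • ((transversalProjR (twistFreq G₀ (classFreq n ℓ (z.1 - (W₁.phase j).m)))).comp (coordL R (z.1 - (W₁.phase j).m))) +
        starRingEnd ℂ (slotAmp W₁ j) • ((transversalProjR (twistFreq G₀ (classFreq n ℓ (z.1 + (W₁.phase j).m)))).comp (coordL R (z.1 + (W₁.phase j).m)))))) y =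
      ∑ j, linkCoeff W₁ n (classFreq n ℓ z.1) j t • transversalProjR (twistFreq G₀ (classFreq n ℓ z.1))
        (slotAmp W₁ j • transversalProjR (twistFreq G₀ (classFreq n ℓ (z.1 - (W₁.phase j).m))) (coordL R (z.1 - (W₁.phase j).m) y) +
          starRingEnd ℂ (slotAmp W₁ j) • transversalProjR (twistFreq G₀ (classFreq n ℓ (z.1 + (W₁.phase j).m))) (coordL R (z.1 + (W₁.phase j).m) y)) := by
    rw [sum_apply]
    refine Finset.sum_congr rfl fun j _ => ?_
    rw [smul_apply, ContinuousLinearMap.comp_apply, add_apply, smul_apply, smul_apply, ContinuousLinearMap.comp_apply,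
      ContinuousLinearMap.comp_apply]
  rw [genXCompθ, sub_apply, sub_apply, neg_apply, smul_apply, smul_apply, hsum, ContinuousLinearMap.comp_apply,
    ContinuousLinearMap.comp_apply, ContinuousLinearMap.comp_apply, symbTL_apply, sub_apply, ContinuousLinearMap.comp_apply]

/-- **The fibre balance of the finite-ξ generator**: for `z ∈ box`,
`Re⟪(genX y)_z, y_z⟫ = −4π²·Re⟪P T_{𝔹ᵀ}(k_z) P y_z, y_z⟫ − γ₁(‖y_z‖² − ‖P y_z‖²) − Re⟪Σⱼ linkⱼ, y_z⟫`. [cite: MajdaKramer1999, §2.2.1.3] -/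
theorem re_inner_genXCompθ (W₁ : LatticeWord k₀) (n : ℕ) (ℓ : Fin 3 → ℤ) (𝔹 : Torus.Visc4 (Fin 3)) (G₀ : Matrix (Fin 3) (Fin 3) ℝ) (γ₁ : ℝ) (R : ℕ) (t : ℝ) (z : box R) (y : Space R) :
    (⟪genXCompθ W₁ n ℓ 𝔹 G₀ γ₁ R t z y, y z⟫_ℂ).re =
      -(4 * Real.pi ^ 2 * (⟪transversalProjR (twistFreq G₀ (classFreq n ℓ z.1))
          (Torus.symbT (Torus.majorTranspose (Torus.Visc4.conj G₀ 𝔹)) (classFreq n ℓ z.1) (transversalProjR (twistFreq G₀ (classFreq n ℓ z.1)) (y z))), y z⟫_ℂ).re) -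
      γ₁ * (‖y z‖ ^ 2 - ‖transversalProjR (twistFreq G₀ (classFreq n ℓ z.1)) (y z)‖ ^ 2) -
      ∑ j, (⟪linkCoeff W₁ n (classFreq n ℓ z.1) j t • transversalProjR (twistFreq G₀ (classFreq n ℓ z.1))
        (slotAmp W₁ j • transversalProjR (twistFreq G₀ (classFreq n ℓ (z.1 - (W₁.phase j).m))) (coordL R (z.1 - (W₁.phase j).m) y) +
          starRingEnd ℂ (slotAmp W₁ j) • transversalProjR (twistFreq G₀ (classFreq n ℓ (z.1 + (W₁.phase j).m))) (coordL R (z.1 + (W₁.phase j).m) y)),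
        y z⟫_ℂ).re := by
  rw [genXCompθ_apply, coordL_apply_of_mem z.2, inner_sub_left, inner_sub_left, inner_neg_left, inner_smul_left, inner_smul_left, sum_inner,
    Complex.sub_re, Complex.sub_re, Complex.neg_re, Complex.conj_ofReal, Complex.conj_ofReal, Complex.re_ofReal_mul,
    Complex.re_ofReal_mul, re_inner_sub_transversalProjR G₀, Complex.re_sum]

/-- **`⟪genX y, y⟫_ℝ` EXACTLY**: the links create no energy, so for ALL `y ∈ Space R`,
`⟪genX y, y⟫_ℝ = −4π² Σ_z Re⟪P T_{𝔹ᵀ}(k_z) P y_z, y_z⟫ − γ₁ Σ_z (‖y_z‖² − ‖P_{k_z} y_z‖²)`. [cite: MajdaKramer1999, §2.2.1.3] -/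
theorem real_inner_genXθ_eq (W₁ : LatticeWord k₀) (n : ℕ) (ℓ : Fin 3 → ℤ) (𝔹 : Torus.Visc4 (Fin 3)) (G₀ : Matrix (Fin 3) (Fin 3) ℝ) (γ₁ : ℝ) (R : ℕ) (t : ℝ) (y : Space R) :
    ⟪genXθ W₁ n ℓ 𝔹 G₀ γ₁ R t y, y⟫_ℝ =
      -(4 * Real.pi ^ 2) * ∑ z : box R, (⟪transversalProjR (twistFreq G₀ (classFreq n ℓ z.1))
          (Torus.symbT (Torus.majorTranspose (Torus.Visc4.conj G₀ 𝔹)) (classFreq n ℓ z.1) (transversalProjR (twistFreq G₀ (classFreq n ℓ z.1)) (y z))), y z⟫_ℂ).re -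
      γ₁ * ∑ z : box R, (‖y z‖ ^ 2 - ‖transversalProjR (twistFreq G₀ (classFreq n ℓ z.1)) (y z)‖ ^ 2) := by
  classical
  rw [real_inner_space_eq_sum]
  have hterm : ∀ z : box R, (⟪genXθ W₁ n ℓ 𝔹 G₀ γ₁ R t y z, y z⟫_ℂ).re = _ := fun z => by rw [genXθ_apply, re_inner_genXCompθ]
  rw [Finset.sum_congr rfl fun z _ => hterm z, Finset.sum_sub_distrib, Finset.sum_comm, Finset.sum_eq_zero
    (fun j _ => sum_re_inner_linkX_eq_zero_frame W₁ n ℓ G₀ R j t y), sub_zero, Finset.sum_sub_distrib, Finset.mul_sum, Finset.mul_sum]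
  congr 1
  refine Finset.sum_congr rfl fun z _ => ?_
  ring

/-- **DISSIPATIVITY OF `genX` WITH THE SYMBOL FORM RETAINED**: for `NearIso 𝔹 lo' hi'`, `lo' ≥ 0`, and ALL `y`,
`⟪genX y, y⟫_ℝ ≤ −4π²·lo'·Σ_z |k_z|²·‖P_{k_z} y_z‖² − γ₁·Σ_z (‖y_z‖² − ‖P_{k_z} y_z‖²)`. [cite: MajdaKramer1999, §2.2.1.3]
[cite: Giaquinta1983MultipleIntegrals, Ch. III §2 eq. (2.2)] -/
theorem real_inner_genXθ_le_twist (W₁ : LatticeWord k₀) (n : ℕ) (ℓ : Fin 3 → ℤ) {𝔹 : Torus.Visc4 (Fin 3)} {lo' hi' : ℝ} (h𝔹 : Torus.NearIso 𝔹 lo' hi')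
    (G₀ : Matrix (Fin 3) (Fin 3) ℝ) (γ₁ : ℝ) (R : ℕ) (t : ℝ) (y : Space R) :
    ⟪genXθ W₁ n ℓ 𝔹 G₀ γ₁ R t y, y⟫_ℝ ≤
      -(4 * Real.pi ^ 2 * lo') * ∑ z : box R, (∑ a, twistFreq G₀ (classFreq n ℓ z.1) a ^ 2) * ‖transversalProjR (twistFreq G₀ (classFreq n ℓ z.1)) (y z)‖ ^ 2 -
      γ₁ * ∑ z : box R, (‖y z‖ ^ 2 - ‖transversalProjR (twistFreq G₀ (classFreq n ℓ z.1)) (y z)‖ ^ 2) := by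
  rw [real_inner_genXθ_eq]
  have hT : Torus.NearIso (Torus.majorTranspose 𝔹) lo' hi' := (Torus.nearIso_majorTranspose_iff 𝔹 lo' hi').2 h𝔹
  have hz : ∀ z : box R, lo' * ((∑ a, twistFreq G₀ (classFreq n ℓ z.1) a ^ 2) * ‖transversalProjR (twistFreq G₀ (classFreq n ℓ z.1)) (y z)‖ ^ 2) ≤
      (⟪transversalProjR (twistFreq G₀ (classFreq n ℓ z.1)) (Torus.symbT (Torus.majorTranspose (Torus.Visc4.conj G₀ 𝔹)) (classFreq n ℓ z.1)
        (transversalProjR (twistFreq G₀ (classFreq n ℓ z.1)) (y z))), y z⟫_ℂ).re := by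
    intro z
    have hkdot' : rdot (twistFreq G₀ (classFreq n ℓ z.1)) (transversalProjR (twistFreq G₀ (classFreq n ℓ z.1)) (y z)) = 0 :=
      rdot_transversalProjR' _ _
    have h1 : (⟪transversalProjR (twistFreq G₀ (classFreq n ℓ z.1)) (Torus.symbT (Torus.majorTranspose (Torus.Visc4.conj G₀ 𝔹)) (classFreq n ℓ z.1)
        (transversalProjR (twistFreq G₀ (classFreq n ℓ z.1)) (y z))), y z⟫_ℂ).re =
        (⟪transversalProjR (twistFreq G₀ (classFreq n ℓ z.1)) (y z), Torus.symbT (Torus.Visc4.conj G₀ (Torus.majorTranspose 𝔹)) (classFreq n ℓ z.1)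
          (transversalProjR (twistFreq G₀ (classFreq n ℓ z.1)) (y z))⟫_ℂ).re := by
      rw [inner_transversalProjR_comm, ← inner_conj_symm, Complex.conj_re, Torus.Visc4.conj_majorTranspose]
    rw [h1]
    exact Torus.lo_mul_le_re_inner_symbT_conj hT G₀ hkdot'
  have hsum := Finset.sum_le_sum fun z (_ : z ∈ Finset.univ) => hz z
  rw [← Finset.mul_sum] at hsum
  have h4 : 0 ≤ 4 * Real.pi ^ 2 := by positivity
  have := mul_le_mul_of_nonneg_left hsum h4
  linarith

/-- **DISSIPATIVITY OF `genXθ` UNDER THE FRAME HYPOTHESIS** (`c|k|² ≤ |G₀ᵀk|²`, `0 ≤ c`, `lo' ≥ 0`): the flat dissipation form with `lo' ↦ lo'·c`,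
`⟪genXθ y, y⟫_ℝ ≤ −4π²·(lo' c)·Σ_z |k_z|²·‖P^θ_{k_z} y_z‖² − γ₁·Σ_z (‖y_z‖² − ‖P^θ y_z‖²)`. [cite: MajdaKramer1999, §2.2.1.3] [cite: ArmstrongVicol2025, §4.1 (PDF p. 34)] -/
theorem real_inner_genXθ_le (W₁ : LatticeWord k₀) (n : ℕ) (ℓ : Fin 3 → ℤ) {𝔹 : Torus.Visc4 (Fin 3)} {lo' hi' : ℝ} (h𝔹 : Torus.NearIso 𝔹 lo' hi')
    (hlo' : 0 ≤ lo') (G₀ : Matrix (Fin 3) (Fin 3) ℝ) {c : ℝ} (hG : ∀ k : Fin 3 → ℤ, c * freqNormSq k ≤ ∑ a, twistFreq G₀ k a ^ 2)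
    (γ₁ : ℝ) (R : ℕ) (t : ℝ) (y : Space R) :
    ⟪genXθ W₁ n ℓ 𝔹 G₀ γ₁ R t y, y⟫_ℝ ≤
      -(4 * Real.pi ^ 2 * (lo' * c)) * ∑ z : box R, freqNormSq (classFreq n ℓ z.1) * ‖transversalProjR (twistFreq G₀ (classFreq n ℓ z.1)) (y z)‖ ^ 2 -
      γ₁ * ∑ z : box R, (‖y z‖ ^ 2 - ‖transversalProjR (twistFreq G₀ (classFreq n ℓ z.1)) (y z)‖ ^ 2) := by
  have h := real_inner_genXθ_le_twist W₁ n ℓ h𝔹 G₀ γ₁ R t y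
  have hsum : c * ∑ z : box R, freqNormSq (classFreq n ℓ z.1) * ‖transversalProjR (twistFreq G₀ (classFreq n ℓ z.1)) (y z)‖ ^ 2 ≤
      ∑ z : box R, (∑ a, twistFreq G₀ (classFreq n ℓ z.1) a ^ 2) * ‖transversalProjR (twistFreq G₀ (classFreq n ℓ z.1)) (y z)‖ ^ 2 := by
    rw [Finset.mul_sum]
    refine Finset.sum_le_sum fun z _ => ?_
    rw [← mul_assoc]
    exact mul_le_mul_of_nonneg_right (hG _) (sq_nonneg _)
  have h4 : 0 ≤ 4 * Real.pi ^ 2 * lo' := by positivity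
  nlinarith [mul_le_mul_of_nonneg_left hsum h4]

end Summit.AnomalousDissipation.AnomalousDissipation.Theorems.SolenoidalFractalHomogenisation.LagrangianStep.Sideband

end
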